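import Summits.QuantumFields.BalabanUV.Beta.GAN24.WardResidualRotatedVertexWeighted
import Summits.QuantumFields.BalabanUV.Beta.GAN24.SlotMomentParity

/-!
# `BalabanUV.Beta.GAN24.WardResidualRotatedVertexInversion` — binder row G-an2-4 ∕ (CONV-C), CT-W «WC-TL» → «QR-LL», the (S) row of RULING R-gan24p1-g27-1
# PART B (viii) (the OWNER gan24-p1 g27, journal l.41890), sub-step (INV-X): **THE (α) PROFILE UNDER THE SLOT INVERSION IS THE END-POINT ROTATED VERTEX'S PROFILE**
# (road-P2 chair `b2b-balaban-gan24-p2`, gen 39 — first refusal on (INV-X) exercised; joint with leaf-06 g45's (γ) side)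

NOT IN PRINT; OUR BOOKKEEPING ([folklore] `tsum` re-indexing by lattice involutions + the block arithmetic of the point inversion; the covariance of the comb kernel's
columns (INV-G) and of the tables' ω-charges (INV-Z) are DISPLAYED HYPOTHESES in the shapes PART B names; 0 `def`, 0 cited fact, 0 `def … : Prop`, 0 sorry).
HONEST FRAMING (cell contract, verbatim): «discharging `BetaPertH` makes Bałaban's UV stability UNCONDITIONAL — a real constructive-QFT result; it is NOT the continuum
limit and NOT the Clay problem.»  HONEST DEPENDENCY (verbatim): «continuum YM on T⁴ ⇐ BetaPertH ∧ nine spine estimates (0/9 proved); BetaPertH ⇐ (D1) ∧ (D4) ∧ CAP+tail;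
G-an2-4 gates asym, D1 and NE2/3/4.»

WHAT.  The slot involution of `SlotMomentParity` is `σ_ν : y′ ↦ 2•y − e_ν − y′` (point inversion of the coarse bond `(ν, y′)` through the label `y`).  On fine legs the
block-compatible point inversion through the centre of `B(y)` is `u ↦ c_y − u`, `c_y := Lc•(2•y) + (Lc−1)•𝟙`; a FIELD leg `(κ, u)` (bond from `u` to `u + e_κ`) goes to
`(κ, c_y − e_κ − u)` (the image bond, base point first), a MULTIPLIER leg `(ρ, Lc•w)` to `(ρ, Lc•(2•y − e_ρ − w))`.  The (α) profile of `WardResidualRotatedVertexWeighted` §3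
carries the BASE-POINT symbol «`½𝟙[y′ = y] − ½𝟙[blk u = y]`» ∕ «`½𝟙[y′ = y] − ½𝟙[w = y]`» (the block generator `X_y` sees a leg through its base point: forward star);
under the inversion base points become END points: «`½𝟙[y′ + e_ν = y] − ½𝟙[blk (u + e_κ) = y]`» ∕ «`½𝟙[y′ + e_ν = y] − ½𝟙[w + e_ρ = y]`» (backward star) — the
symbol of the END-POINT generator `X⁺_y`, `g⁺(z, c) := g(z + step c, c)`, `step (inl κ) = e_κ`, `step (inr μ) = Lc•e_μ`.
* §1 `profile_slotInv_generic` — pure re-indexing: two profiles of the shape `½·[Σ_κ Σ'_u cH·pF·Z_S + Σ_ρ Σ'_w cM·pM·Z_M]` agree at `σ y′` resp. `y′` as soon as the columns,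
  the profile factors and the charges are intertwined by leg involutions with signs multiplying to one.
* §2 block arithmetic of the point inversion: `blk_reflect` (`blk ((Lc−1)•𝟙 − v) = −blk v`), `blk_pointInv` (`blk (c_y − u) = 2•y − blk u`).
* §3 THE COMB INSTANCE **`weightedProfile_comb_slotInv`**: for `G_{j+1} = coDressKBmAt ρ Lc (KInvStep Lc (j+1))`, `S = SpureRecAt … (j+1)`, `M = M1At … (j+1)`, label `y`,
  slot direction `ν`, channel `(a,b)`, weights `ω` (read at the inverted slot) and `ω′` (read at the direct slot): UNDER (INV-G) «`colH G ν (σ_ν y′) κ (c_y − e_κ − u) =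
  s_κ·colH G ν y′ κ u`, `colM G ν (σ_ν y′) ρ (2•y − e_ρ − w) = s′_ρ·colM G ν y′ ρ w`» and (INV-Z) «`Z_ω(S κ (c_y − e_κ − u)) = t_κ·Z_ω′(S κ u)`,
  `Z_ω(M ρ (2•y − e_ρ − w)) = t′_ρ·Z_ω′(M ρ w)`», `s·t = 1 = s′·t′`:  **`V^{base}_{Z_ω}(ν, σ_ν y′) = V^{end}_{Z_ω′}(ν, y′)`**.
* §4 the END-POINT rotated vertex `(α⁺) := ½ • dM (conjV G_{j+1} X⁺_y) Lc S M ν y′` in closed form (`rotatedVertexEnd_eq`) and its ω-charge per slot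
  (`hasSum_weighted_rotatedVertexEnd_comb` = `V^{end}_{Z_ω}`); hence **`weightedCharge_rotatedVertex_slotInv`**: under (INV-G) ∕ (INV-Z) the ω-charge of (α) at the slot
  `σ_ν y′` IS the ω′-charge of (α⁺) at the slot `y′` — (INV-X) of PART B (viii) in its structural half: the slot inversion EXCHANGES THE FORWARD AND THE BACKWARD STAR.
* §5 the glue to the OWNER's `SlotMomentParity`: `slotInv_of_geo_of_ward` ((INV-X-geo) «`Vα(σ_ν y′) = ε·V⁺(y′)`» ∧ (W-γ) «`Qγ(y′) = ε·V⁺(y′)`» ⇒ `Vα + Qγ` is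
  `σ_ν`-invariant — pure algebra, `σ_ν ∘ σ_ν = id`) and `tsum_slotMoment_pair_eq_zero` (+ envelope + zero mass ⇒ all first slot-moments of the σ-pair vanish:
  `SlotMomentParity.tsum_slotMoment_eq_zero_of_slotInv`).
WHAT THIS DOES NOT DO.  (INV-G) is an2's `refK_coDressKBmAt_KInvStep` composed over the `d+1` axes plus `shiftK_coDressKBmAt_KInvStep` (asym1 g115 W-2: the composition lemma
is not in the tree) — DISPLAYED; (INV-Z) is a statement about an1's tables' charges — DISPLAYED; the identification «(γ)-profile at `y′` = (α⁺)-profile at `y′`» (the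
remaining, Ward-type half of PART B (viii)'s «(γ)(y′) = (α)(σ_ν y′)») is NOT claimed here (engine test E26 of this seat).  Asserts NO value of Bałaban's tables; discharges
NOTHING of (S) ∕ (Q-R) ∕ (LT) ∕ (Q-L) ∕ (C) ∕ «T2Shape» ∕ «T2Drift» ∕ (hW, hWall); NEVER «G-an2-4 closed» as (CONV-C); NOT D1, NOT BetaPertH, NOT continuum, NOT Clay.
2026-08-22; no existing file touched.
-/

noncomputable section

open Finset
open scoped BigOperators
open Literature.MathematicalPhysics.QuantumFieldTheory
open Literature.MathematicalPhysics.QuantumFieldTheory.Balaban1983to89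
open Literature.MathematicalPhysics.QuantumFieldTheory.Balaban1983to89.Beta
open B12Sec2to5 (l1)
open ExpKernelCalculus (Site MKer BiLoc Decays VertexFamily shiftK)
open AffineAveraging (box toSite)
open AveragingContours (blk blk_block)
open AxialProjector (blk_add_zsmul)
open OneStepResolventKernel (Fib LocStencil wsum)
open OneStepKernelFamily (KInvStep colH vertexOfK abs_colH_le)
open SecondOrderResponse (colM vertexOfM dM dM_apply abs_colM_le)
open Summit.QuantumFields.BalabanUV.Beta.BorderedHessian (diagK)
open Summit.QuantumFields.BalabanUV.Beta.ChartConjugation (conjV)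
open Summit.QuantumFields.BalabanUV.Beta.AveragingWardRootedStencils (legInd)
open Summit.QuantumFields.BalabanUV.Beta.AxialDressingRooted (coDressKBmAt decays_coDressKBmAt_KInvStep)
open Summit.QuantumFields.BalabanUV.Beta.SpineRooted (SpureRecAt M1At locStencil_SpureRecAt vertexFamily_M1At)
open Summit.QuantumFields.BalabanUV.Beta.WardLocusResidualClass (abs_blockGen_le)
open Summit.QuantumFields.BalabanUV.Beta.GAN24.WardResidualLabelSums (decays_conjV_diagK)
open Summit.QuantumFields.BalabanUV.Beta.GAN24.WardResidualRotatedVertex (colH_conjV_diagK colM_conjV_diagK dM_conjV_diagK blockGen_inl blockGen_zsmul_inr)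
open Summit.QuantumFields.BalabanUV.Beta.GAN24.WardResidualRotatedVertexWeighted (hasSum_weighted_dM hasSum_weighted_rotatedVertex_comb)

namespace Summit.QuantumFields.BalabanUV.Beta.GAN24.WardResidualRotatedVertexInversion

variable {d : ℕ}

/-! ## §1 Pure re-indexing: a profile read at the inverted slot is the intertwined profile at the direct slot -/

/-- [folklore] **RE-INDEXING LEMMA.**  Two profiles of the (α) shape `½·[Σ_κ Σ'_u cH y′ κ u·pF y′ κ u·Z_S κ u + Σ_ρ Σ'_w cM y′ ρ w·pM y′ ρ w·Z_M ρ w]`: if leg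
bijections `PF κ`, `PM ρ` and a slot map `σ` intertwine the columns (signs `s`, `s′`), the profile factors, and the charges (signs `t`, `t′`) with `s·t = ε = s′·t′`, then the
first profile at `σ y′` equals `ε` times the second at `y′` (`ε = s·t = s′·t′`, a sign in the applications). -/
theorem profile_slotInv_generic (cH cM pF pF' pM pM' : Site (d + 1) → Fin (d + 1) → Site (d + 1) → ℝ)
    (ZS ZS' ZM ZM' : Fin (d + 1) → Site (d + 1) → ℝ) (σ : Site (d + 1) → Site (d + 1))
    (PF PM : Fin (d + 1) → Site (d + 1) ≃ Site (d + 1)) (s t s' t' : Fin (d + 1) → ℝ) (ε : ℝ)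
    (hst : ∀ κ, s κ * t κ = ε) (hst' : ∀ ρ, s' ρ * t' ρ = ε)
    (hH : ∀ y' κ u, cH (σ y') κ (PF κ u) = s κ * cH y' κ u) (hM : ∀ y' ρ w, cM (σ y') ρ (PM ρ w) = s' ρ * cM y' ρ w)
    (hpF : ∀ y' κ u, pF (σ y') κ (PF κ u) = pF' y' κ u) (hpM : ∀ y' ρ w, pM (σ y') ρ (PM ρ w) = pM' y' ρ w)
    (hZS : ∀ κ u, ZS κ (PF κ u) = t κ * ZS' κ u) (hZM : ∀ ρ w, ZM ρ (PM ρ w) = t' ρ * ZM' ρ w) (y' : Site (d + 1)) :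
    (1 / 2 : ℝ) * ((∑ κ : Fin (d + 1), ∑' u : Site (d + 1), cH (σ y') κ u * pF (σ y') κ u * ZS κ u)
        + ∑ ρ : Fin (d + 1), ∑' w : Site (d + 1), cM (σ y') ρ w * pM (σ y') ρ w * ZM ρ w)
      = ε * ((1 / 2 : ℝ) * ((∑ κ : Fin (d + 1), ∑' u : Site (d + 1), cH y' κ u * pF' y' κ u * ZS' κ u)
        + ∑ ρ : Fin (d + 1), ∑' w : Site (d + 1), cM y' ρ w * pM' y' ρ w * ZM' ρ w)) := by
  have hF : ∀ κ : Fin (d + 1), ∑' u : Site (d + 1), cH (σ y') κ u * pF (σ y') κ u * ZS κ u = ε * ∑' u : Site (d + 1), cH y' κ u * pF' y' κ u * ZS' κ u := by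
    intro κ
    rw [← (PF κ).tsum_eq (fun u => cH (σ y') κ u * pF (σ y') κ u * ZS κ u), ← tsum_mul_left]
    refine tsum_congr fun u => ?_
    rw [hH, hpF, hZS]
    calc s κ * cH y' κ u * pF' y' κ u * (t κ * ZS' κ u) = (s κ * t κ) * (cH y' κ u * pF' y' κ u * ZS' κ u) := by ring
      _ = _ := by rw [hst]
  have hMp : ∀ ρ : Fin (d + 1), ∑' w : Site (d + 1), cM (σ y') ρ w * pM (σ y') ρ w * ZM ρ w = ε * ∑' w : Site (d + 1), cM y' ρ w * pM' y' ρ w * ZM' ρ w := by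
    intro ρ
    rw [← (PM ρ).tsum_eq (fun w => cM (σ y') ρ w * pM (σ y') ρ w * ZM ρ w), ← tsum_mul_left]
    refine tsum_congr fun w => ?_
    rw [hM, hpM, hZM]
    calc s' ρ * cM y' ρ w * pM' y' ρ w * (t' ρ * ZM' ρ w) = (s' ρ * t' ρ) * (cM y' ρ w * pM' y' ρ w * ZM' ρ w) := by ring
      _ = _ := by rw [hst']
  simp only [hF, hMp, ← Finset.mul_sum]
  ring

/-! ## §2 Block arithmetic of the point inversion through the centre of a block -/

section Blk

variable {Lc : ℕ}

/-- [folklore] One coordinate: `((Lc − 1) − a) / Lc = −(a / Lc)` for `1 ≤ Lc` (floor division). -/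
theorem ediv_reflect (hLc : 1 ≤ Lc) (a : ℤ) : (((Lc : ℤ) - 1) - a) / (Lc : ℤ) = -(a / (Lc : ℤ)) := by
  have hL0 : (0 : ℤ) < Lc := by exact_mod_cast hLc
  have hL : (Lc : ℤ) ≠ 0 := hL0.ne'
  have h1 : a % (Lc : ℤ) + a / (Lc : ℤ) * (Lc : ℤ) = a := Int.emod_add_ediv_mul a (Lc : ℤ)
  have h2 := Int.emod_nonneg a hL
  have h3 := Int.emod_lt_of_pos a hL0
  have e : ((Lc : ℤ) - 1) - a = ((Lc : ℤ) - 1 - a % (Lc : ℤ)) + -(a / (Lc : ℤ)) * (Lc : ℤ) := by linarith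
  rw [e, Int.add_mul_ediv_right _ _ hL, Int.ediv_eq_zero_of_lt (by linarith) (by linarith), zero_add]

/-- [folklore] The block index of the reflected offset: `blk ((Lc−1)•𝟙 − v) = −blk v`. -/
theorem blk_reflect (hLc : 1 ≤ Lc) (v : Site (d + 1)) : blk Lc (toSite (fun _ : Fin (d + 1) => Lc - 1) - v) = -blk Lc v := by
  funext i
  simp only [blk, Pi.sub_apply, Pi.neg_apply, toSite]
  rw [Nat.cast_sub hLc, Nat.cast_one]
  exact ediv_reflect hLc (v i)

/-- [folklore] **THE POINT INVERSION THROUGH THE CENTRE OF `B(y)` INVERTS BLOCK INDICES THROUGH `y`**: `blk (Lc•(2•y) + (Lc−1)•𝟙 − u) = 2•y − blk u`. -/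
theorem blk_pointInv (hLc : 1 ≤ Lc) (y u : Site (d + 1)) :
    blk Lc ((Lc : ℤ) • ((2 : ℕ) • y) + toSite (fun _ : Fin (d + 1) => Lc - 1) - u) = (2 : ℕ) • y - blk Lc u := by
  rw [show (Lc : ℤ) • ((2 : ℕ) • y) + toSite (fun _ : Fin (d + 1) => Lc - 1) - u = (toSite (fun _ : Fin (d + 1) => Lc - 1) - u) + (Lc : ℤ) • ((2 : ℕ) • y) by abel,
    blk_add_zsmul hLc, blk_reflect hLc]
  abel

/-- [folklore] The image of a field leg's base point has its END point in `B(y)` iff the leg's end point is: `blk (c_y − e_κ − u) = y ↔ blk (u + e_κ) = y`. -/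
theorem blk_pointInv_eq_iff (hLc : 1 ≤ Lc) (y u : Site (d + 1)) (κ : Fin (d + 1)) :
    blk Lc ((Lc : ℤ) • ((2 : ℕ) • y) + toSite (fun _ : Fin (d + 1) => Lc - 1) - Pi.single κ 1 - u) = y ↔ blk Lc (u + Pi.single κ 1) = y := by
  rw [show (Lc : ℤ) • ((2 : ℕ) • y) + toSite (fun _ : Fin (d + 1) => Lc - 1) - Pi.single κ 1 - u =
      (Lc : ℤ) • ((2 : ℕ) • y) + toSite (fun _ : Fin (d + 1) => Lc - 1) - (u + Pi.single κ 1) by abel, blk_pointInv hLc]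
  constructor
  · intro h
    have h2 := (sub_eq_iff_eq_add).1 h
    calc blk Lc (u + Pi.single κ 1) = (y + blk Lc (u + Pi.single κ 1)) - y := by abel
      _ = (2 : ℕ) • y - y := by rw [← h2]
      _ = y := by rw [two_nsmul, add_sub_cancel_right]
  · intro h; rw [h, two_nsmul, add_sub_cancel_right]

/-- [folklore] The coarse slot involution fixes the label's backward star: `2•y − e_ρ − w = y ↔ w + e_ρ = y`. -/
theorem slotInv_eq_iff (y w : Site (d + 1)) (ρ : Fin (d + 1)) :
    (2 : ℕ) • y - Pi.single ρ (1 : ℤ) - w = y ↔ w + Pi.single ρ 1 = y := by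
  constructor
  · intro h
    have h2 := (sub_eq_iff_eq_add).1 h
    calc w + Pi.single ρ 1 = ((y + w) + Pi.single ρ 1) - y := by abel
      _ = ((2 : ℕ) • y - Pi.single ρ 1 + Pi.single ρ 1) - y := by rw [← h2]
      _ = y := by rw [sub_add_cancel, two_nsmul, add_sub_cancel_right]
  · intro h; rw [← h, two_nsmul]; abel

end Blk

/-! ## §3 The comb instance: the (α) profile at the inverted slot is the END-POINT profile, given (INV-G) and (INV-Z) -/

section Comb

variable {Lc : ℕ} [NeZero Lc]

/-- NOT IN PRINT; OUR BOOKKEEPING.  **(INV-X), STRUCTURAL HALF: THE SLOT INVERSION EXCHANGES THE FORWARD AND THE BACKWARD STAR** (the OWNER gan24-p1 g27's RULING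
R-gan24p1-g27-1 PART B (viii); road-P2's first refusal).  For `G_{j+1} = coDressKBmAt ρ Lc (KInvStep Lc (j+1))`, `S = SpureRecAt … (j+1)`, `M = M1At … (j+1)`, a label `y`,
a slot direction `ν`, a channel `(a, b)`, two-leg weights `ω` (read at the inverted slot) and `ω′` (read at the direct slot), the fine point inversion
`u ↦ c_y − u`, `c_y = Lc•(2•y) + (Lc−1)•𝟙`, acting on field legs as `(κ, u) ↦ (κ, c_y − e_κ − u)` and on multiplier legs as `(ρ, w) ↦ (ρ, 2•y − e_ρ − w)`:
UNDER THE DISPLAYED HYPOTHESES (INV-G) «`colH G ν (2•y − e_ν − y′) κ (c_y − e_κ − u) = s_κ·colH G ν y′ κ u`», «`colM G ν (2•y − e_ν − y′) ρ (2•y − e_ρ − w) =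
s′_ρ·colM G ν y′ ρ w`» and (INV-Z) «`Z_ω(S κ (c_y − e_κ − u)) = t_κ·Z_ω′(S κ u)`», «`Z_ω(M ρ (2•y − e_ρ − w)) = t′_ρ·Z_ω′(M ρ w)`», `s·t = ε = s′·t′`:
the (α) ω-charge profile of `WardResidualRotatedVertexWeighted.hasSum_weighted_rotatedVertex_comb` (BASE-POINT symbol «`½𝟙[y′ = y] − ½𝟙[blk u = y]`» ∕
«`½𝟙[y′ = y] − ½𝟙[w = y]`») read at the slot `2•y − e_ν − y′` EQUALS `ε` times the END-POINT profile («`½𝟙[y′ + e_ν = y] − ½𝟙[blk (u + e_κ) = y]`» ∕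
«`½𝟙[y′ + e_ν = y] − ½𝟙[w + e_ρ = y]`») with the charges `Z_ω′` read at the slot `y′`.  Pure re-indexing (§1) + the block arithmetic of §2; NO value of any column or
charge is asserted, (INV-G) and (INV-Z) are NOT discharged here. -/
theorem weightedProfile_comb_slotInv (hLc : 1 ≤ Lc) (ρc : Site (d + 1)) (cE cVH cΛ : ℝ) (j : ℕ) (y : Site (d + 1)) (ν : Fin (d + 1)) (a b : Fib d)
    (ω ω' : Site (d + 1) × Site (d + 1) → ℝ) (s t s' t' : Fin (d + 1) → ℝ) (ε : ℝ) (hst : ∀ κ, s κ * t κ = ε) (hst' : ∀ ρ, s' ρ * t' ρ = ε)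
    (hGH : ∀ (y' : Site (d + 1)) (κ : Fin (d + 1)) (u : Site (d + 1)),
      colH (coDressKBmAt ρc Lc (KInvStep (d := d) Lc (j + 1))) Lc ν ((2 : ℕ) • y - Pi.single ν 1 - y') κ
          ((Lc : ℤ) • ((2 : ℕ) • y) + toSite (fun _ : Fin (d + 1) => Lc - 1) - Pi.single κ 1 - u)
        = s κ * colH (coDressKBmAt ρc Lc (KInvStep (d := d) Lc (j + 1))) Lc ν y' κ u)
    (hGM : ∀ (y' : Site (d + 1)) (ρ : Fin (d + 1)) (w : Site (d + 1)),
      colM (coDressKBmAt ρc Lc (KInvStep (d := d) Lc (j + 1))) Lc ν ((2 : ℕ) • y - Pi.single ν 1 - y') ρ ((2 : ℕ) • y - Pi.single ρ 1 - w)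
        = s' ρ * colM (coDressKBmAt ρc Lc (KInvStep (d := d) Lc (j + 1))) Lc ν y' ρ w)
    (hZS : ∀ (κ : Fin (d + 1)) (u : Site (d + 1)),
      ∑' xz : Site (d + 1) × Site (d + 1), ω xz * SpureRecAt d Lc ρc cE cVH cΛ (j + 1) κ
          ((Lc : ℤ) • ((2 : ℕ) • y) + toSite (fun _ : Fin (d + 1) => Lc - 1) - Pi.single κ 1 - u) xz.1 xz.2 a b
        = t κ * ∑' xz : Site (d + 1) × Site (d + 1), ω' xz * SpureRecAt d Lc ρc cE cVH cΛ (j + 1) κ u xz.1 xz.2 a b)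
    (hZM : ∀ (ρ : Fin (d + 1)) (w : Site (d + 1)),
      ∑' xz : Site (d + 1) × Site (d + 1), ω xz * M1At d Lc ρc cΛ (j + 1) ρ ((2 : ℕ) • y - Pi.single ρ 1 - w) xz.1 xz.2 a b
        = t' ρ * ∑' xz : Site (d + 1) × Site (d + 1), ω' xz * M1At d Lc ρc cΛ (j + 1) ρ w xz.1 xz.2 a b)
    (y' : Site (d + 1)) :
    (1 / 2 : ℝ) *
        ((∑ κ : Fin (d + 1), ∑' u : Site (d + 1),
            colH (coDressKBmAt ρc Lc (KInvStep (d := d) Lc (j + 1))) Lc ν ((2 : ℕ) • y - Pi.single ν 1 - y') κ u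
              * ((if (2 : ℕ) • y - Pi.single ν 1 - y' = y then (1 / 2 : ℝ) else 0) - (if blk Lc u = y then (1 / 2 : ℝ) else 0))
              * ∑' xz : Site (d + 1) × Site (d + 1), ω xz * SpureRecAt d Lc ρc cE cVH cΛ (j + 1) κ u xz.1 xz.2 a b)
          + ∑ ρ' : Fin (d + 1), ∑' w : Site (d + 1),
            colM (coDressKBmAt ρc Lc (KInvStep (d := d) Lc (j + 1))) Lc ν ((2 : ℕ) • y - Pi.single ν 1 - y') ρ' w
              * ((if (2 : ℕ) • y - Pi.single ν 1 - y' = y then (1 / 2 : ℝ) else 0) - (if w = y then (1 / 2 : ℝ) else 0))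
              * ∑' xz : Site (d + 1) × Site (d + 1), ω xz * M1At d Lc ρc cΛ (j + 1) ρ' w xz.1 xz.2 a b)
      = ε * ((1 / 2 : ℝ) *
        ((∑ κ : Fin (d + 1), ∑' u : Site (d + 1),
            colH (coDressKBmAt ρc Lc (KInvStep (d := d) Lc (j + 1))) Lc ν y' κ u
              * ((if y' + Pi.single ν 1 = y then (1 / 2 : ℝ) else 0) - (if blk Lc (u + Pi.single κ 1) = y then (1 / 2 : ℝ) else 0))
              * ∑' xz : Site (d + 1) × Site (d + 1), ω' xz * SpureRecAt d Lc ρc cE cVH cΛ (j + 1) κ u xz.1 xz.2 a b)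
          + ∑ ρ' : Fin (d + 1), ∑' w : Site (d + 1),
            colM (coDressKBmAt ρc Lc (KInvStep (d := d) Lc (j + 1))) Lc ν y' ρ' w
              * ((if y' + Pi.single ν 1 = y then (1 / 2 : ℝ) else 0) - (if w + Pi.single ρ' 1 = y then (1 / 2 : ℝ) else 0))
              * ∑' xz : Site (d + 1) × Site (d + 1), ω' xz * M1At d Lc ρc cΛ (j + 1) ρ' w xz.1 xz.2 a b)) := by
  -- the two condition rewrites of §2 (slot and leg)
  have eS : ∀ y₁ : Site (d + 1), ((2 : ℕ) • y - Pi.single ν 1 - y₁ = y) = (y₁ + Pi.single ν 1 = y) := fun y₁ => propext (slotInv_eq_iff y y₁ ν)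
  have eF : ∀ (κ : Fin (d + 1)) (u : Site (d + 1)),
      (blk Lc ((Lc : ℤ) • ((2 : ℕ) • y) + toSite (fun _ : Fin (d + 1) => Lc - 1) - Pi.single κ 1 - u) = y) = (blk Lc (u + Pi.single κ 1) = y) :=
    fun κ u => propext (blk_pointInv_eq_iff hLc y u κ)
  have eM : ∀ (ρ : Fin (d + 1)) (w : Site (d + 1)), ((2 : ℕ) • y - Pi.single ρ 1 - w = y) = (w + Pi.single ρ 1 = y) := fun ρ w => propext (slotInv_eq_iff y w ρ)
  -- field half: re-index `u ↦ c_y − e_κ − u`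
  have hF : ∀ κ : Fin (d + 1),
      ∑' u : Site (d + 1), colH (coDressKBmAt ρc Lc (KInvStep (d := d) Lc (j + 1))) Lc ν ((2 : ℕ) • y - Pi.single ν 1 - y') κ u
          * ((if (2 : ℕ) • y - Pi.single ν 1 - y' = y then (1 / 2 : ℝ) else 0) - (if blk Lc u = y then (1 / 2 : ℝ) else 0))
          * ∑' xz : Site (d + 1) × Site (d + 1), ω xz * SpureRecAt d Lc ρc cE cVH cΛ (j + 1) κ u xz.1 xz.2 a b
        = ε * ∑' u : Site (d + 1), colH (coDressKBmAt ρc Lc (KInvStep (d := d) Lc (j + 1))) Lc ν y' κ u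
          * ((if y' + Pi.single ν 1 = y then (1 / 2 : ℝ) else 0) - (if blk Lc (u + Pi.single κ 1) = y then (1 / 2 : ℝ) else 0))
          * ∑' xz : Site (d + 1) × Site (d + 1), ω' xz * SpureRecAt d Lc ρc cE cVH cΛ (j + 1) κ u xz.1 xz.2 a b := by
    intro κ
    let E : Site (d + 1) ≃ Site (d + 1) :=
      Equiv.subLeft (((Lc : ℤ) • ((2 : ℕ) • y) + toSite (fun _ : Fin (d + 1) => Lc - 1) - Pi.single κ 1 : Site (d + 1)))
    rw [← tsum_mul_left]
    refine (E.tsum_eq _).symm.trans ?_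
    refine tsum_congr fun u => ?_
    simp only [E, Equiv.subLeft_apply, eS, eF]
    rw [hGH, hZS]
    calc s κ * colH (coDressKBmAt ρc Lc (KInvStep (d := d) Lc (j + 1))) Lc ν y' κ u
          * ((if y' + Pi.single ν 1 = y then (1 / 2 : ℝ) else 0) - (if blk Lc (u + Pi.single κ 1) = y then (1 / 2 : ℝ) else 0))
          * (t κ * ∑' xz : Site (d + 1) × Site (d + 1), ω' xz * SpureRecAt d Lc ρc cE cVH cΛ (j + 1) κ u xz.1 xz.2 a b)
        = (s κ * t κ) * (colH (coDressKBmAt ρc Lc (KInvStep (d := d) Lc (j + 1))) Lc ν y' κ u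
          * ((if y' + Pi.single ν 1 = y then (1 / 2 : ℝ) else 0) - (if blk Lc (u + Pi.single κ 1) = y then (1 / 2 : ℝ) else 0))
          * ∑' xz : Site (d + 1) × Site (d + 1), ω' xz * SpureRecAt d Lc ρc cE cVH cΛ (j + 1) κ u xz.1 xz.2 a b) := by ring
      _ = _ := by rw [hst]
  -- multiplier half: re-index `w ↦ 2•y − e_ρ − w`
  have hMp : ∀ ρ' : Fin (d + 1),
      ∑' w : Site (d + 1), colM (coDressKBmAt ρc Lc (KInvStep (d := d) Lc (j + 1))) Lc ν ((2 : ℕ) • y - Pi.single ν 1 - y') ρ' w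
          * ((if (2 : ℕ) • y - Pi.single ν 1 - y' = y then (1 / 2 : ℝ) else 0) - (if w = y then (1 / 2 : ℝ) else 0))
          * ∑' xz : Site (d + 1) × Site (d + 1), ω xz * M1At d Lc ρc cΛ (j + 1) ρ' w xz.1 xz.2 a b
        = ε * ∑' w : Site (d + 1), colM (coDressKBmAt ρc Lc (KInvStep (d := d) Lc (j + 1))) Lc ν y' ρ' w
          * ((if y' + Pi.single ν 1 = y then (1 / 2 : ℝ) else 0) - (if w + Pi.single ρ' 1 = y then (1 / 2 : ℝ) else 0))
          * ∑' xz : Site (d + 1) × Site (d + 1), ω' xz * M1At d Lc ρc cΛ (j + 1) ρ' w xz.1 xz.2 a b := by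
    intro ρ'
    let E : Site (d + 1) ≃ Site (d + 1) := Equiv.subLeft (((2 : ℕ) • y - Pi.single ρ' (1 : ℤ) : Site (d + 1)))
    rw [← tsum_mul_left]
    refine (E.tsum_eq _).symm.trans ?_
    refine tsum_congr fun w => ?_
    simp only [E, Equiv.subLeft_apply, eS, eM]
    rw [hGM, hZM]
    calc s' ρ' * colM (coDressKBmAt ρc Lc (KInvStep (d := d) Lc (j + 1))) Lc ν y' ρ' w
          * ((if y' + Pi.single ν 1 = y then (1 / 2 : ℝ) else 0) - (if w + Pi.single ρ' 1 = y then (1 / 2 : ℝ) else 0))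
          * (t' ρ' * ∑' xz : Site (d + 1) × Site (d + 1), ω' xz * M1At d Lc ρc cΛ (j + 1) ρ' w xz.1 xz.2 a b)
        = (s' ρ' * t' ρ') * (colM (coDressKBmAt ρc Lc (KInvStep (d := d) Lc (j + 1))) Lc ν y' ρ' w
          * ((if y' + Pi.single ν 1 = y then (1 / 2 : ℝ) else 0) - (if w + Pi.single ρ' 1 = y then (1 / 2 : ℝ) else 0))
          * ∑' xz : Site (d + 1) × Site (d + 1), ω' xz * M1At d Lc ρc cΛ (j + 1) ρ' w xz.1 xz.2 a b) := by ring
      _ = _ := by rw [hst']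
  simp only [hF, hMp, ← Finset.mul_sum]
  ring

end Comb

/-! ## §4 The END-POINT rotated vertex `(α⁺)` and the charge form of (INV-X)'s structural half -/

section EndPoint

variable {Lc : ℕ} [NeZero Lc]

omit [NeZero Lc] in
/-- [folklore] The END-POINT comb symbol `g⁺(z, c) := g(z + step c, c)` (`g = ξ • Σ_{v∈box} legInd ρ (Lc•y + v)`, `step (inr μ) = Lc•e_μ`) on a MULTIPLIER leg at a
coarse point: `ξ·𝟙[w + e_ρ′ = y]` — the BACKWARD star of `y` (`WardResidualRotatedVertex.blockGen_zsmul_inr` at `w + e_ρ′`). -/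
theorem blockGenEnd_zsmul_inr {r : Fin (d + 1) → ℕ} (hr : r ∈ box (d + 1) Lc) (ξ : ℝ) (y w : Site (d + 1)) (ρ' : Fin (d + 1)) :
    (ξ • ∑ v ∈ box (d + 1) Lc, legInd (toSite r) ((Lc : ℤ) • y + toSite v)) ((Lc : ℤ) • w + (Lc : ℤ) • (Pi.single ρ' 1 : Site (d + 1))) (Sum.inr ρ')
      = if w + Pi.single ρ' 1 = y then ξ else 0 := by
  rw [← smul_add]
  exact blockGen_zsmul_inr hr ξ y (w + Pi.single ρ' 1) ρ'

/-- NOT IN PRINT; OUR BOOKKEEPING.  **THE END-POINT ROTATED VERTEX `(α⁺)` IN CLOSED FORM** (`WardResidualRotatedVertex.rotatedVertex_eq` for the end-point generator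
`X⁺_y = diagK g⁺`, `g⁺(z, c) = g(z + step c, c)`, `step (inl κ) = e_κ`, `step (inr μ) = Lc•e_μ`; any `G`, `S`, `M`):
`½ • dM (conjV G X⁺_y) Lc S M ν y′ = ½ • dM G Lc (fun κ u ↦ (½𝟙[y′ + e_ν = y] − ½𝟙[blk (u + e_κ) = y]) • S κ u) (fun ρ′ w ↦ (½𝟙[y′ + e_ν = y] − ½𝟙[w + e_ρ′ = y]) • M ρ′ w) ν y′`
— «slot END in `y` minus leg END in `y`». -/
theorem rotatedVertexEnd_eq (hLc : 1 ≤ Lc) {r : Fin (d + 1) → ℕ} (hr : r ∈ box (d + 1) Lc) (G : MKer (d + 1) (Fib d))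
    (S M : Fin (d + 1) → Site (d + 1) → MKer (d + 1) (Fib d)) (y : Site (d + 1)) (ν : Fin (d + 1)) (y' : Site (d + 1)) :
    (1 / 2 : ℝ) • dM (conjV G (diagK (fun z c =>
        (((1 : ℝ) / 2) • ∑ v ∈ box (d + 1) Lc, legInd (toSite r) ((Lc : ℤ) • y + toSite v))
          (z + Sum.elim (fun κ => (Pi.single κ 1 : Site (d + 1))) (fun μ => (Lc : ℤ) • (Pi.single μ 1 : Site (d + 1))) c) c))) Lc S M ν y' =
      (1 / 2 : ℝ) • dM G Lc
        (fun κ u => ((if y' + Pi.single ν 1 = y then (1 / 2 : ℝ) else 0) - (if blk Lc (u + Pi.single κ 1) = y then (1 / 2 : ℝ) else 0)) • S κ u)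
        (fun ρ' w => ((if y' + Pi.single ν 1 = y then (1 / 2 : ℝ) else 0) - (if w + Pi.single ρ' 1 = y then (1 / 2 : ℝ) else 0)) • M ρ' w) ν y' := by
  rw [dM_conjV_diagK]
  simp only [Sum.elim_inl, Sum.elim_inr, blockGen_inl hLc, blockGenEnd_zsmul_inr hr]

/-- NOT IN PRINT; OUR BOOKKEEPING.  **THE ω-CHARGE OF `(α⁺)` PER SLOT** (`WardResidualRotatedVertexWeighted.hasSum_weighted_rotatedVertex_comb` for the end-point generator): for
`G_{j+1}`, `S = SpureRecAt … (j+1)`, `M = M1At … (j+1)`, every slot `(ν, y′)`, channel `(a,b)` and `|ω| ≤ B`, the ω-charge of `(α⁺)` at `(ν, y′)` is the END-POINT profile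
`V⁺_Z(y′) = ½·[Σ_κ Σ'_u colH G ν y′ κ u·(½𝟙[y′ + e_ν = y] − ½𝟙[blk (u + e_κ) = y])·Z_S(κ,u) + Σ_ρ′ Σ'_w colM G ν y′ ρ′ w·(½𝟙[y′ + e_ν = y] − ½𝟙[w + e_ρ′ = y])·Z_M(ρ′,w)]`. -/
theorem hasSum_weighted_rotatedVertexEnd_comb (hLc : 1 ≤ Lc) {r : Fin (d + 1) → ℕ} (hr : r ∈ box (d + 1) Lc) (cE cVH cΛ : ℝ) (j : ℕ)
    (y : Site (d + 1)) (ν : Fin (d + 1)) (y' : Site (d + 1)) (a b : Fib d) {ω : Site (d + 1) × Site (d + 1) → ℝ} {B : ℝ} (hω : ∀ xz, |ω xz| ≤ B) :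
    HasSum (fun xz : Site (d + 1) × Site (d + 1) => ω xz *
        ((1 / 2 : ℝ) • dM (conjV (coDressKBmAt (toSite r) Lc (KInvStep (d := d) Lc (j + 1))) (diagK (fun z c =>
            (((1 : ℝ) / 2) • ∑ v ∈ box (d + 1) Lc, legInd (toSite r) ((Lc : ℤ) • y + toSite v))
              (z + Sum.elim (fun κ => (Pi.single κ 1 : Site (d + 1))) (fun μ => (Lc : ℤ) • (Pi.single μ 1 : Site (d + 1))) c) c))) Lc
          (SpureRecAt d Lc (toSite r) cE cVH cΛ (j + 1)) (M1At d Lc (toSite r) cΛ (j + 1)) ν y') xz.1 xz.2 a b)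
      ((1 / 2 : ℝ) *
        ((∑ κ : Fin (d + 1), ∑' u : Site (d + 1),
            colH (coDressKBmAt (toSite r) Lc (KInvStep (d := d) Lc (j + 1))) Lc ν y' κ u
              * ((if y' + Pi.single ν 1 = y then (1 / 2 : ℝ) else 0) - (if blk Lc (u + Pi.single κ 1) = y then (1 / 2 : ℝ) else 0))
              * ∑' xz : Site (d + 1) × Site (d + 1), ω xz * SpureRecAt d Lc (toSite r) cE cVH cΛ (j + 1) κ u xz.1 xz.2 a b)
          + ∑ ρ' : Fin (d + 1), ∑' w : Site (d + 1),
            colM (coDressKBmAt (toSite r) Lc (KInvStep (d := d) Lc (j + 1))) Lc ν y' ρ' w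
              * ((if y' + Pi.single ν 1 = y then (1 / 2 : ℝ) else 0) - (if w + Pi.single ρ' 1 = y then (1 / 2 : ℝ) else 0))
              * ∑' xz : Site (d + 1) × Site (d + 1), ω xz * M1At d Lc (toSite r) cΛ (j + 1) ρ' w xz.1 xz.2 a b)) := by
  obtain ⟨δG, CG, hδG, hCG, hG⟩ := decays_coDressKBmAt_KInvStep (d := d) hr (j + 1)
  have hg : ∀ p c, |(fun z c => (((1 : ℝ) / 2) • ∑ v ∈ box (d + 1) Lc, legInd (toSite r) ((Lc : ℤ) • y + toSite v))
      (z + Sum.elim (fun κ => (Pi.single κ 1 : Site (d + 1))) (fun μ => (Lc : ℤ) • (Pi.single μ 1 : Site (d + 1))) c) c) p c| ≤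
      |((1 : ℝ) / 2)| * (box (d + 1) Lc).card := fun p c => abs_blockGen_le Lc (toSite r) _ y _ c
  have hK := decays_conjV_diagK hG hg
  obtain ⟨Cs, δs, hδs, hS⟩ := locStencil_SpureRecAt (d := d) (Lc := Lc) hLc hr cE cVH cΛ (j + 1)
  have hM := vertexFamily_M1At (d := d) hLc hr cΛ (j + 1) (zero_le_one)
  have h := (hasSum_weighted_dM (c₀ := (Lc : ℤ) • y') (c₁ := (Lc : ℤ) • y') ν y' (fun κ t => abs_colH_le (N := Lc) hK ν y' κ t)
    (fun ρ w => abs_colM_le (N := Lc) hK ν y' ρ w) hδG hS hδs hM one_pos a b hω).mul_left (1 / 2 : ℝ)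
  simp only [colH_conjV_diagK, colM_conjV_diagK, Sum.elim_inl, Sum.elim_inr, blockGen_inl hLc, blockGenEnd_zsmul_inr hr] at h
  refine h.congr_fun fun xz => ?_
  simp only [Pi.smul_apply, smul_eq_mul]
  ring

/-- NOT IN PRINT; OUR BOOKKEEPING.  **(INV-X), STRUCTURAL HALF, IN CHARGE: THE ω-CHARGE OF (α) AT THE INVERTED SLOT IS `ε` TIMES THE ω′-CHARGE OF `(α⁺)` AT THE SLOT.**
In the setting of `weightedProfile_comb_slotInv` (in-block root `ρ = toSite r`; (INV-G), (INV-Z) DISPLAYED; `|ω| ≤ B`): whatever value `v` the ω′-charge of the end-point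
rotated vertex `(α⁺)_y` has at the slot `(ν, y′)`, the ω-charge of `(α)_y = ½ • dM (conjV G_{j+1} X_y) Lc S M` at the slot `(ν, 2•y − e_ν − y′)` is `ε·v`.
(PART B (viii)'s remaining half «(γ)(y′) = (α)(2•y − e_ν − y′)» is thus EQUIVALENT, under (INV-G)∕(INV-Z), to «(γ)(y′) = ε·(α⁺)(y′)» — a statement WITHOUT the
inversion; NOT claimed here.) -/
theorem weightedCharge_rotatedVertex_slotInv (hLc : 1 ≤ Lc) {r : Fin (d + 1) → ℕ} (hr : r ∈ box (d + 1) Lc) (cE cVH cΛ : ℝ) (j : ℕ)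
    (y : Site (d + 1)) (ν : Fin (d + 1)) (a b : Fib d) {ω ω' : Site (d + 1) × Site (d + 1) → ℝ} {B : ℝ} (hω : ∀ xz, |ω xz| ≤ B)
    (s t s' t' : Fin (d + 1) → ℝ) (ε : ℝ) (hst : ∀ κ, s κ * t κ = ε) (hst' : ∀ ρ, s' ρ * t' ρ = ε)
    (hGH : ∀ (y' : Site (d + 1)) (κ : Fin (d + 1)) (u : Site (d + 1)),
      colH (coDressKBmAt (toSite r) Lc (KInvStep (d := d) Lc (j + 1))) Lc ν ((2 : ℕ) • y - Pi.single ν 1 - y') κ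
          ((Lc : ℤ) • ((2 : ℕ) • y) + toSite (fun _ : Fin (d + 1) => Lc - 1) - Pi.single κ 1 - u)
        = s κ * colH (coDressKBmAt (toSite r) Lc (KInvStep (d := d) Lc (j + 1))) Lc ν y' κ u)
    (hGM : ∀ (y' : Site (d + 1)) (ρ : Fin (d + 1)) (w : Site (d + 1)),
      colM (coDressKBmAt (toSite r) Lc (KInvStep (d := d) Lc (j + 1))) Lc ν ((2 : ℕ) • y - Pi.single ν 1 - y') ρ ((2 : ℕ) • y - Pi.single ρ 1 - w)
        = s' ρ * colM (coDressKBmAt (toSite r) Lc (KInvStep (d := d) Lc (j + 1))) Lc ν y' ρ w)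
    (hZS : ∀ (κ : Fin (d + 1)) (u : Site (d + 1)),
      ∑' xz : Site (d + 1) × Site (d + 1), ω xz * SpureRecAt d Lc (toSite r) cE cVH cΛ (j + 1) κ
          ((Lc : ℤ) • ((2 : ℕ) • y) + toSite (fun _ : Fin (d + 1) => Lc - 1) - Pi.single κ 1 - u) xz.1 xz.2 a b
        = t κ * ∑' xz : Site (d + 1) × Site (d + 1), ω' xz * SpureRecAt d Lc (toSite r) cE cVH cΛ (j + 1) κ u xz.1 xz.2 a b)
    (hZM : ∀ (ρ : Fin (d + 1)) (w : Site (d + 1)),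
      ∑' xz : Site (d + 1) × Site (d + 1), ω xz * M1At d Lc (toSite r) cΛ (j + 1) ρ ((2 : ℕ) • y - Pi.single ρ 1 - w) xz.1 xz.2 a b
        = t' ρ * ∑' xz : Site (d + 1) × Site (d + 1), ω' xz * M1At d Lc (toSite r) cΛ (j + 1) ρ w xz.1 xz.2 a b)
    (y' : Site (d + 1)) {B' : ℝ} (hω' : ∀ xz, |ω' xz| ≤ B') {v : ℝ}
    (hv : HasSum (fun xz : Site (d + 1) × Site (d + 1) => ω' xz *
        ((1 / 2 : ℝ) • dM (conjV (coDressKBmAt (toSite r) Lc (KInvStep (d := d) Lc (j + 1))) (diagK (fun z c =>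
            (((1 : ℝ) / 2) • ∑ v ∈ box (d + 1) Lc, legInd (toSite r) ((Lc : ℤ) • y + toSite v))
              (z + Sum.elim (fun κ => (Pi.single κ 1 : Site (d + 1))) (fun μ => (Lc : ℤ) • (Pi.single μ 1 : Site (d + 1))) c) c))) Lc
          (SpureRecAt d Lc (toSite r) cE cVH cΛ (j + 1)) (M1At d Lc (toSite r) cΛ (j + 1)) ν y') xz.1 xz.2 a b) v) :
    HasSum (fun xz : Site (d + 1) × Site (d + 1) => ω xz *
        ((1 / 2 : ℝ) • dM (conjV (coDressKBmAt (toSite r) Lc (KInvStep (d := d) Lc (j + 1)))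
            (diagK (((1 : ℝ) / 2) • ∑ v ∈ box (d + 1) Lc, legInd (toSite r) ((Lc : ℤ) • y + toSite v)))) Lc
          (SpureRecAt d Lc (toSite r) cE cVH cΛ (j + 1)) (M1At d Lc (toSite r) cΛ (j + 1)) ν ((2 : ℕ) • y - Pi.single ν 1 - y')) xz.1 xz.2 a b)
      (ε * v) := by
  have hend := hasSum_weighted_rotatedVertexEnd_comb hLc hr cE cVH cΛ j y ν y' a b hω'
  rw [hv.unique hend]
  have h := hasSum_weighted_rotatedVertex_comb hLc hr cE cVH cΛ j y ν ((2 : ℕ) • y - Pi.single ν 1 - y') a b hω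
  rw [weightedProfile_comb_slotInv hLc (toSite r) cE cVH cΛ j y ν a b ω ω' s t s' t' ε hst hst' hGH hGM hZS hZM y'] at h
  exact h

end EndPoint

/-! ## §5 The glue to `SlotMomentParity`: (INV-X-geo) ∧ (W-γ) ⇒ the σ-pair's profile is slot-inversion invariant -/

/-- [folklore] **THE σ-PAIR IS SLOT-INVERSION INVARIANT** (pure algebra on profiles; the shape consumed by the OWNER's `SlotMomentParity.moments_of_slotInv`,
`hinv : ∀ e, Z (2•y − e_ν − e) = Z e`).  If the (α) profile satisfies (INV-X-geo) «`Vα (2•y − e_ν − y′) = ε·V⁺ y′`» for EVERY slot (§4, under (INV-G)∕(INV-Z) with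
`ω′ = ω`) and the (γ) profile satisfies (W-γ) «`Qγ y′ = ε·V⁺ y′`» with THE SAME `ε` (the Ward-type half; DISPLAYED), then `Z := Vα + Qγ` is invariant under the slot
involution — whence, with (M0), all first slot-moments of the σ-pair vanish ((Π)_j for the α+γ sector).  No hypothesis on `ε`; only `σ ∘ σ = id` is used. -/
theorem slotInv_of_geo_of_ward {Vα Vend Qγ : Site (d + 1) → ℝ} (y : Site (d + 1)) (ν : Fin (d + 1)) (ε : ℝ)
    (hgeo : ∀ y' : Site (d + 1), Vα ((2 : ℕ) • y - Pi.single ν 1 - y') = ε * Vend y')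
    (hW : ∀ y' : Site (d + 1), Qγ y' = ε * Vend y') (y' : Site (d + 1)) :
    Vα ((2 : ℕ) • y - Pi.single ν 1 - y') + Qγ ((2 : ℕ) • y - Pi.single ν 1 - y') = Vα y' + Qγ y' := by
  have hσσ : (2 : ℕ) • y - Pi.single ν 1 - ((2 : ℕ) • y - Pi.single ν 1 - y') = y' := by abel
  have h1 : Vα y' = ε * Vend ((2 : ℕ) • y - Pi.single ν 1 - y') := by rw [← hgeo, hσσ]
  rw [hgeo, hW, hW, h1]
  ring

/-- [folklore] **… AND THEN ALL FIRST SLOT-MOMENTS OF THE σ-PAIR VANISH** — the OWNER's `SlotMomentParity.tsum_slotMoment_eq_zero_of_slotInv` fed with §5's invariance: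
exponential envelope of `Vα + Qγ` about the label (`hZb`; for the literal pieces: `GaugeReadChargeProfile.abs_weightedGaugeCharge_le` and its (α) analogue) and zero mass
(`hM0`; `WardResidualRotatedVertexWeighted.hasSum_totalCharge_weighted_comb` + leaf-06's `hasSum_comb_gaugeCharge_mass_zero`) DISPLAYED. -/
theorem tsum_slotMoment_pair_eq_zero {Vα Vend Qγ : Site (d + 1) → ℝ} (y : Site (d + 1)) (ν : Fin (d + 1)) (ε : ℝ) {B δ : ℝ} (hδ : 0 < δ)
    (hgeo : ∀ y' : Site (d + 1), Vα ((2 : ℕ) • y - Pi.single ν 1 - y') = ε * Vend y')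
    (hW : ∀ y' : Site (d + 1), Qγ y' = ε * Vend y')
    (hZb : ∀ e : Site (d + 1), |Vα e + Qγ e| ≤ B * Real.exp (-δ * l1 (e - y))) (hM0 : ∑' e : Site (d + 1), (Vα e + Qγ e) = 0) (lam : Fin (d + 1)) :
    ∑' e : Site (d + 1), (((e - y) lam : ℤ) : ℝ) * (Vα e + Qγ e) = 0 :=
  SlotMomentParity.tsum_slotMoment_eq_zero_of_slotInv (Z := fun e => Vα e + Qγ e) y ν hδ hZb
    (fun e => slotInv_of_geo_of_ward y ν ε hgeo hW e) hM0 lam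

end Summit.QuantumFields.BalabanUV.Beta.GAN24.WardResidualRotatedVertexInversion

end
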